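import Summits.QuantumFields.YangMills.Theorems.LuscherReductionTwistedTraceScalingBTOffDiagonalRatio
import Summits.QuantumFields.YangMills.Theorems.LuscherReductionTwistedTraceScalingQuaternionStep
import Summits.QuantumFields.YangMills.Theorems.LuscherReductionTwistedTraceScalingCovariantCurlLipschitz
import HarnessLib

/-!
# (L2) NEAR PAIRS, the pointwise bound: `|offX| ≤ β·O(|E|·α·t² + α·τ_u·|Σ_x g⃗_x|) + (β/2)·O((σ + α)·N·‖v̂'‖² + E(t,σ))` on the core, and the integrated two-sided
# near-pair comparison (lane A of S-BASE, crux `TwistedTraceScaling` stmt-QuantumFields-20203, C4-CORE, the (B-T) pen; design note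
# `pub/ym-fleet/ym-luscher-20007-p1/COARSE-DESIGN.md` §25.6 (L2), §25.7)

With `w_k = u_ku'_k⁻¹ = (w⁰_k, a⃗_k)`, `|a⃗_{k,c}| ≤ α`, and the link quaternion `Q_e = chart(v'_e)⁻¹·g_x⁻¹·chart(v_e)·Ad_{u_k}(g_y)` (`linkQ`):
* `cube_mul_timeCoupling_sub_self` — the one-site anchor `L³(TC₁(u,u') − TC₁(u,u)) = Σ_e 2(w⁰_k − 1)`; ★ `offKinetic_eq` — the kinetic part of `offX` is EXACTLY
  `Σ_e 2[(w⁰_k − 1)(Q⁰_e − 1) − a⃗_k·Q⃗_e]`;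
* ★ `linkQ_near` — four near-identity factors (`abs_vecPart_prod4_sub_sum_le`): `Q⃗_e = −v'_e − g⃗_x + v_e + Ad_{u_k}g⃗_y + O(32t²)`, `0 ≤ 1 − Q⁰_e ≤ 93t²`;
* `sum_dotProduct_balanced_eq_zero` (balance kills `Σ_e a⃗_k·v_e`), `sum_dotProduct_adRot_shift_sub_eq` (torus telescoping: `Σ_e a⃗_k·(Ad_{u_k}g⃗_{x+k} − g⃗_x) = Σ_k a⃗_k·((Ad_{u_k} − 1)G⃗)`,
  `G⃗ = Σ_x g⃗_x` — the ONLY first-order survivor, tiny on the Faddeev–Popov slab), `norm_adRot_mulVec_sub_self_le` (`‖(Ad_u − 1)x‖ ≤ 12‖u⃗‖‖x‖`);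
* ★★ `abs_offKinetic_le` — `|kinetic| ≤ |E|(558α²t² + 192αt²) + 216·α·τ_u·Γ` (`‖G⃗‖ ≤ Γ`, `‖u⃗_k‖ ≤ τ_u`);
* ★★ `abs_offMagnetic_le` — `|(S(oT u' v') − L³S₁u') − (S(oT u v') − L³S₁u)| ≤ 100σN‖v̂'‖² + 2E(t,σ) + 10080·α·N‖v̂'‖²` (`abs_wilsonAction_orthoTube_sub_le` twice and the
  Lipschitz lemma `norm_covCurl_step_sub_le` along the constant step `constLift(u'u⁻¹)`);
* ★★★ `abs_offX_le` — the pointwise bound (the successor `…BTOffDiagonalNear` integrates it against the balanced-cap fibre law).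
Sizes of record (`t = r_β ≍ β^{-1/2}log β`, `α ≤ B^{-1/2}log β`, `Γ ≤ β^{-1}|Λ|`, `σ ≍ β^{-2s}`): `β·η-terms = O(log³β·β^{-1/2}) → 0`, far inside the (B-T) rate `β^{-2s}`.
HONEST FRAMING: pointwise bookkeeping for a stub of a child of the CONDITIONAL reduction route R2b1; (L1) (far pairs / tails / floor) and the assembly are OPEN; C4-CORE OPEN;
not infinite volume, not a gap, not Clay.
-/

set_option autoImplicit false

noncomputable section

open MeasureTheory Filter Topology Real
open scoped BigOperators Matrix InnerProductSpace RealInnerProductSpace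
open Literature.MathematicalPhysics.QuantumFieldTheory
open Literature.MathematicalPhysics.QuantumLattice

namespace Summit.QuantumFields.YangMills.Theorems.FemtoTransferGap.TwoLattice.ConstTube

open Summit.QuantumFields.YangMills.Theorems.FemtoTransferGap
open Summit.QuantumFields.YangMills.Theorems.FemtoTransferGap.TwoLattice
open Summit.QuantumFields.YangMills.Theorems.FemtoTransferGap.TwoLattice.Avg
open Summit.QuantumFields.YangMills.Theorems.FemtoTransferGap.TwoLattice.Stiff
open Summit.QuantumFields.YangMills.Theorems.FemtoTransferGap.TwoLattice.Cov
open Summit.QuantumFields.YangMills.Theorems.FemtoTransferGap.TwoLattice.Toron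

variable (L : ℕ) [NeZero L]

/-- **The link quaternion** `Q_e = chart(v'_e)⁻¹·g_x⁻¹·chart(v_e)·(u_k g_y u_k⁻¹)` of the off-diagonal kinetic term. [cite: Luscher1983, §3] -/
def linkQ (u : GaugeConfig 3 1 SU2) (v v' : Edge 3 L → Fin 3 → ℝ) (g : Site 3 L → SU2) (e : Edge 3 L) : SU2 :=
  (chartSU2 (v' e))⁻¹ * (g e.1)⁻¹ * chartSU2 (v e) * (u (0, e.2) * g (e.1.shift e.2) * (u (0, e.2))⁻¹)

variable {L}

/-! ## §1 The one-site anchor and the exact kinetic part -/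

/-- The one-site anchor on the big lattice: `L³(TC₁(u,u') − TC₁(u,u)) = Σ_e 2(w⁰_k − 1)`, `w_k = u_ku'_k⁻¹`. [folklore] -/
theorem cube_mul_timeCoupling_sub_self (u u' : GaugeConfig 3 1 SU2) :
    (L : ℝ) ^ 3 * timeCoupling su2Rep u u' - (L : ℝ) ^ 3 * timeCoupling su2Rep u u =
      ∑ e : Edge 3 L, 2 * (scalarPart (u (0, e.2) * (u' (0, e.2))⁻¹) - 1) := by
  rw [← timeCoupling_constLift su2Rep L u u', ← timeCoupling_constLift su2Rep L u u]
  unfold timeCoupling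
  rw [← Finset.sum_sub_distrib]
  refine Finset.sum_congr rfl fun e _ => ?_
  rw [constLift_apply, constLift_apply, re_trace_su2Rep_mul_inv, re_trace_su2Rep_mul_inv, scalarPart_mul_inv]
  have h := scalarPart_sq_add (u (0, e.2))
  have h' : scalarPart (u (0, e.2)) * scalarPart (u (0, e.2)) + vecPart (u (0, e.2)) ⬝ᵥ vecPart (u (0, e.2)) = 1 := by
    rw [← h]; simp only [dotProduct, sq]
  rw [h']; ring

/-- ★ **The kinetic part of `offX`, exactly**: `Σ_e 2[(w⁰_k − 1)(Q⁰_e − 1) − a⃗_k·Q⃗_e]`. [cite: Luscher1983, §3] -/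
theorem offKinetic_eq (u u' : GaugeConfig 3 1 SU2) (g : Site 3 L → SU2) (v v' : Edge 3 L → Fin 3 → ℝ) :
    (timeCoupling su2Rep (orthoTube L u v) (gaugeTransform g (orthoTube L u' v')) - (L : ℝ) ^ 3 * timeCoupling su2Rep u u') -
        (timeCoupling su2Rep (orthoTube L u v) (gaugeTransform g (orthoTube L u v')) - (L : ℝ) ^ 3 * timeCoupling su2Rep u u) =
      ∑ e : Edge 3 L, 2 * ((scalarPart (u (0, e.2) * (u' (0, e.2))⁻¹) - 1) * (scalarPart (linkQ L u v v' g e) - 1) -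
        vecPart (u (0, e.2) * (u' (0, e.2))⁻¹) ⬝ᵥ vecPart (linkQ L u v v' g e)) := by
  have h1 := timeCoupling_orthoTube_gauge_offdiag_sub u u' g v v'
  have h2 := cube_mul_timeCoupling_sub_self (L := L) u u'
  have e : (timeCoupling su2Rep (orthoTube L u v) (gaugeTransform g (orthoTube L u' v')) - (L : ℝ) ^ 3 * timeCoupling su2Rep u u') -
        (timeCoupling su2Rep (orthoTube L u v) (gaugeTransform g (orthoTube L u v')) - (L : ℝ) ^ 3 * timeCoupling su2Rep u u) =
      (timeCoupling su2Rep (orthoTube L u v) (gaugeTransform g (orthoTube L u' v')) - timeCoupling su2Rep (orthoTube L u v) (gaugeTransform g (orthoTube L u v'))) -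
        ((L : ℝ) ^ 3 * timeCoupling su2Rep u u' - (L : ℝ) ^ 3 * timeCoupling su2Rep u u) := by ring
  rw [e, h1, h2, ← Finset.sum_sub_distrib]
  refine Finset.sum_congr rfl fun e _ => ?_
  simp only [linkQ]; ring

/-! ## §2 The link quaternion is four near-identity factors -/

omit [NeZero L] in
/-- ★ `Q⃗_e = −v'_e − g⃗_x + v_e + Ad_{u_k}g⃗_y + O(32t²)` componentwise, `0 ≤ Q⁰_e`, `1 − Q⁰_e ≤ 93t²`. [cite: BrockerTomDieck1985, I (1.10)] -/
theorem linkQ_near (u : GaugeConfig 3 1 SU2) {v v' : Edge 3 L → Fin 3 → ℝ} (hv1 : ∀ e, ∑ a, v e a ^ 2 ≤ 1) (hv'1 : ∀ e, ∑ a, v' e a ^ 2 ≤ 1)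
    {t : ℝ} (ht : t ≤ 1 / 10) (hvt : ∀ (e : Edge 3 L) (c : Fin 3), |v e c| ≤ t) (hv't : ∀ (e : Edge 3 L) (c : Fin 3), |v' e c| ≤ t) {g : Site 3 L → SU2}
    (hg0 : ∀ x, 0 ≤ scalarPart (g x)) (hgt : ∀ x, ∑ c, vecPart (g x) c ^ 2 ≤ t ^ 2) (e : Edge 3 L) :
    (∀ c, |vecPart (linkQ L u v v' g e) c -
        (-(v' e c) + -(vecPart (g e.1) c) + v e c + ((adRot (u (0, e.2))) *ᵥ vecPart (g (e.1.shift e.2))) c)| ≤ 32 * t ^ 2) ∧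
      0 ≤ scalarPart (linkQ L u v v' g e) ∧ 1 - scalarPart (linkQ L u v v' g e) ≤ 93 * t ^ 2 := by
  have ht0 : 0 ≤ t := (abs_nonneg _).trans (hvt e 0)
  have hsq : ∀ y : Fin 3 → ℝ, ∑ c, y c ^ 2 ≤ t ^ 2 → ∀ c, |y c| ≤ t := fun y hy c => by
    have h1 : |y c| ^ 2 ≤ ∑ b, y b ^ 2 := by
      rw [sq_abs]; exact Finset.single_le_sum (f := fun b => y b ^ 2) (fun b _ => sq_nonneg _) (Finset.mem_univ c)
    exact (pow_le_pow_iff_left₀ (abs_nonneg _) ht0 two_ne_zero).mp (h1.trans hy)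
  have hgc : ∀ x c, |vecPart (g x) c| ≤ t := fun x => hsq _ (hgt x)
  have hAd : ∀ c, |((adRot (u (0, e.2))) *ᵥ vecPart (g (e.1.shift e.2))) c| ≤ t :=
    hsq _ (by rw [sum_sq_adRot_mulVec]; exact hgt _)
  have s₁ : 0 ≤ scalarPart ((chartSU2 (v' e))⁻¹) := by rw [scalarPart_inv, scalarPart_chartSU2 (hv'1 e)]; exact Real.sqrt_nonneg _
  have s₂ : 0 ≤ scalarPart ((g e.1)⁻¹) := by rw [scalarPart_inv]; exact hg0 _
  have s₃ : 0 ≤ scalarPart (chartSU2 (v e)) := by rw [scalarPart_chartSU2 (hv1 e)]; exact Real.sqrt_nonneg _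
  have s₄ : 0 ≤ scalarPart (u (0, e.2) * g (e.1.shift e.2) * (u (0, e.2))⁻¹) := by rw [scalarPart_conj]; exact hg0 _
  have a₁ : ∀ i, |vecPart ((chartSU2 (v' e))⁻¹) i| ≤ t := fun i => by
    rw [vecPart_inv, vecPart_chartSU2 (hv'1 e), Pi.neg_apply, abs_neg]; exact hv't e i
  have a₂ : ∀ i, |vecPart ((g e.1)⁻¹) i| ≤ t := fun i => by rw [vecPart_inv, Pi.neg_apply, abs_neg]; exact hgc _ i
  have a₃ : ∀ i, |vecPart (chartSU2 (v e)) i| ≤ t := fun i => by rw [vecPart_chartSU2 (hv1 e)]; exact hvt e i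
  have a₄ : ∀ i, |vecPart (u (0, e.2) * g (e.1.shift e.2) * (u (0, e.2))⁻¹) i| ≤ t := fun i => by rw [vecPart_conj]; exact hAd i
  obtain ⟨d, -, s, s'⟩ := abs_vecPart_prod4_sub_sum_le s₁ s₂ s₃ s₄ ht a₁ a₂ a₃ a₄
  have hassoc : linkQ L u v v' g e =
      (chartSU2 (v' e))⁻¹ * ((g e.1)⁻¹ * (chartSU2 (v e) * (u (0, e.2) * g (e.1.shift e.2) * (u (0, e.2))⁻¹))) := by
    simp only [linkQ, mul_assoc]
  rw [hassoc]
  refine ⟨fun c => ?_, s, s'⟩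
  have h := d c
  rw [vecPart_inv, vecPart_chartSU2 (hv'1 e), vecPart_inv, vecPart_chartSU2 (hv1 e), vecPart_conj, Pi.neg_apply, Pi.neg_apply] at h
  exact h

/-! ## §3 The first-order sums: balance and torus telescoping -/

/-- Balance kills the fibre-linear term: `Σ_e a⃗_k·v_e = 0` for balanced `v`. [folklore] -/
theorem sum_dotProduct_balanced_eq_zero (a : Fin 3 → Fin 3 → ℝ) {v : Edge 3 L → Fin 3 → ℝ} (hv : v ∈ balancedSet L) :
    ∑ e : Edge 3 L, a e.2 ⬝ᵥ v e = 0 := by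
  rw [Fintype.sum_prod_type]
  show ∑ x : Site 3 L, ∑ k : Fin 3, a k ⬝ᵥ v (x, k) = 0
  rw [Finset.sum_comm]
  refine Finset.sum_eq_zero fun k _ => ?_
  simp only [dotProduct]
  rw [Finset.sum_comm]
  refine Finset.sum_eq_zero fun c _ => ?_
  rw [← Finset.mul_sum, hv k c, mul_zero]

/-- Torus telescoping of the gauge-linear term: `Σ_e a⃗_k·(Ad_{u_k}ξ_{x+k} − ξ_x) = Σ_k a⃗_k·((Ad_{u_k} − 1)Σ_x ξ_x)`. [folklore] -/
theorem sum_dotProduct_adRot_shift_sub_eq (a : Fin 3 → Fin 3 → ℝ) (u : GaugeConfig 3 1 SU2) (ξ : Site 3 L → Fin 3 → ℝ) :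
    ∑ e : Edge 3 L, a e.2 ⬝ᵥ ((adRot (u (0, e.2))) *ᵥ ξ (e.1.shift e.2) - ξ e.1) =
      ∑ k : Fin 3, a k ⬝ᵥ ((adRot (u (0, k))) *ᵥ (∑ x : Site 3 L, ξ x) - ∑ x : Site 3 L, ξ x) := by
  rw [Fintype.sum_prod_type]
  show ∑ x : Site 3 L, ∑ k : Fin 3, a k ⬝ᵥ ((adRot (u (0, k))) *ᵥ ξ (x.shift k) - ξ x) = _
  rw [Finset.sum_comm]
  refine Finset.sum_congr rfl fun k _ => ?_
  rw [← dotProduct_sum, Finset.sum_sub_distrib, ← Matrix.mulVec_sum, sum_shift_eq L ξ k]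

/-- `‖(Ad_u − 1)x‖ ≤ 12‖u⃗‖‖x‖` (sup norms). [folklore] -/
theorem norm_adRot_mulVec_sub_self_le (u : SU2) (x : Fin 3 → ℝ) : ‖(adRot u) *ᵥ x - x‖ ≤ 12 * ‖vecPart u‖ * ‖x‖ := by
  rw [adRot_mulVec_sub_eq]
  have hs : |scalarPart u| ≤ 1 := abs_scalarPart_le u
  have hv1 : ‖vecPart u‖ ≤ 1 := norm_vecPart_le_one u
  have h0 : 0 ≤ ‖vecPart u‖ := norm_nonneg _
  have hx0 : 0 ≤ ‖x‖ := norm_nonneg _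
  have h1 : ‖((2 * scalarPart u) • vecPart u) ⨯₃ x‖ ≤ 4 * (‖vecPart u‖ * ‖x‖) := by
    refine (norm_cross_le_two _ _).trans ?_
    rw [norm_smul, Real.norm_eq_abs, abs_mul, abs_two]
    have k := mul_nonneg (sub_nonneg.mpr hs) (mul_nonneg h0 hx0)
    nlinarith [k]
  have h2 : ‖(2 : ℝ) • (vecPart u ⨯₃ (vecPart u ⨯₃ x))‖ ≤ 8 * (‖vecPart u‖ * ‖x‖) := by
    rw [norm_smul, Real.norm_eq_abs, abs_two]
    have h3 := norm_cross_le_two (vecPart u) (vecPart u ⨯₃ x)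
    have h4 := mul_le_mul_of_nonneg_left (norm_cross_le_two (vecPart u) x) h0
    have k2 := mul_le_mul_of_nonneg_right (mul_le_of_le_one_left h0 hv1) hx0
    nlinarith [h3, h4, k2]
  calc ‖((2 * scalarPart u) • vecPart u) ⨯₃ x + (2 : ℝ) • (vecPart u ⨯₃ (vecPart u ⨯₃ x))‖
      ≤ ‖((2 * scalarPart u) • vecPart u) ⨯₃ x‖ + ‖(2 : ℝ) • (vecPart u ⨯₃ (vecPart u ⨯₃ x))‖ := norm_add_le _ _
    _ ≤ 4 * (‖vecPart u‖ * ‖x‖) + 8 * (‖vecPart u‖ * ‖x‖) := add_le_add h1 h2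
    _ = 12 * ‖vecPart u‖ * ‖x‖ := by ring

/-- `1 − w⁰ ≤ 3α²` when `w⁰ ≥ 0` and `|w⃗_c| ≤ α`. [folklore] -/
theorem one_sub_scalarPart_le_three_sq {w : SU2} (h0 : 0 ≤ scalarPart w) {α : ℝ} (ha : ∀ c, |vecPart w c| ≤ α) :
    1 - scalarPart w ≤ 3 * α ^ 2 := by
  have h := scalarPart_sq_add w
  rw [Fin.sum_univ_three] at h
  have h1 : scalarPart w ≤ 1 := (abs_le.mp (abs_scalarPart_le w)).2
  have b0 := pow_le_pow_left₀ (abs_nonneg _) (ha 0) 2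
  have b1 := pow_le_pow_left₀ (abs_nonneg _) (ha 1) 2
  have b2 := pow_le_pow_left₀ (abs_nonneg _) (ha 2) 2
  rw [sq_abs] at b0 b1 b2
  nlinarith [mul_nonneg h0 (sub_nonneg.mpr h1)]

/-! ## §4 ★★ The kinetic bound -/

/-- ★★ **The off-diagonal kinetic term is `O(|E|·α·t²) + O(α·τ_u·|Σ_x g⃗_x|)`.** [cite: Luscher1983, §3] -/
theorem abs_offKinetic_le (u u' : GaugeConfig 3 1 SU2) {v v' : Edge 3 L → Fin 3 → ℝ} (hv : v ∈ capBalancedSet L) (hv' : v' ∈ capBalancedSet L)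
    {t α τu Γ : ℝ} (ht : t ≤ 1 / 10) (hvt : ∀ (e : Edge 3 L) (c : Fin 3), |v e c| ≤ t) (hv't : ∀ (e : Edge 3 L) (c : Fin 3), |v' e c| ≤ t)
    {g : Site 3 L → SU2} (hg0 : ∀ x, 0 ≤ scalarPart (g x)) (hgt : ∀ x, ∑ c, vecPart (g x) c ^ 2 ≤ t ^ 2) (hΓ : ‖∑ x, vecPart (g x)‖ ≤ Γ)
    (ha : ∀ k c, |vecPart (u (0, k) * (u' (0, k))⁻¹) c| ≤ α) (hw0 : ∀ k, 0 ≤ scalarPart (u (0, k) * (u' (0, k))⁻¹))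
    (hu : ∀ k, ‖vecPart (u (0, k))‖ ≤ τu) :
    |∑ e : Edge 3 L, 2 * ((scalarPart (u (0, e.2) * (u' (0, e.2))⁻¹) - 1) * (scalarPart (linkQ L u v v' g e) - 1) -
        vecPart (u (0, e.2) * (u' (0, e.2))⁻¹) ⬝ᵥ vecPart (linkQ L u v v' g e))| ≤
      (Fintype.card (Edge 3 L) : ℝ) * (558 * α ^ 2 * t ^ 2 + 192 * α * t ^ 2) + 216 * α * τu * Γ := by
  have hv1 : ∀ e : Edge 3 L, ∑ a, v e a ^ 2 ≤ 1 := sum_sq_le_one_of_cap L hv.2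
  have hv'1 : ∀ e : Edge 3 L, ∑ a, v' e a ^ 2 ≤ 1 := sum_sq_le_one_of_cap L hv'.2
  have ht0 : 0 ≤ t := (abs_nonneg _).trans (hvt default 0)
  have hα0 : 0 ≤ α := (abs_nonneg _).trans (ha 0 0)
  have hτu0 : 0 ≤ τu := (norm_nonneg _).trans (hu 0)
  have hΓ0 : 0 ≤ Γ := (norm_nonneg _).trans hΓ
  have near := fun e : Edge 3 L => linkQ_near (L := L) u hv1 hv'1 ht hvt hv't hg0 hgt e
  -- per-edge decomposition of the dot product
  have hdec : ∀ e : Edge 3 L, vecPart (u (0, e.2) * (u' (0, e.2))⁻¹) ⬝ᵥ vecPart (linkQ L u v v' g e) =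
      vecPart (u (0, e.2) * (u' (0, e.2))⁻¹) ⬝ᵥ (vecPart (linkQ L u v v' g e) -
          fun c => -(v' e c) + -(vecPart (g e.1) c) + v e c + ((adRot (u (0, e.2))) *ᵥ vecPart (g (e.1.shift e.2))) c) +
        vecPart (u (0, e.2) * (u' (0, e.2))⁻¹) ⬝ᵥ ((adRot (u (0, e.2))) *ᵥ vecPart (g (e.1.shift e.2)) - vecPart (g e.1)) +
        vecPart (u (0, e.2) * (u' (0, e.2))⁻¹) ⬝ᵥ v e - vecPart (u (0, e.2) * (u' (0, e.2))⁻¹) ⬝ᵥ v' e := fun e => by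
    rw [← dotProduct_add, ← dotProduct_add, ← dotProduct_sub]
    congr 1
    funext c
    simp only [Pi.add_apply, Pi.sub_apply]
    ring
  have hsplit : ∀ e : Edge 3 L, 2 * ((scalarPart (u (0, e.2) * (u' (0, e.2))⁻¹) - 1) * (scalarPart (linkQ L u v v' g e) - 1) -
        vecPart (u (0, e.2) * (u' (0, e.2))⁻¹) ⬝ᵥ vecPart (linkQ L u v v' g e)) =
      2 * ((scalarPart (u (0, e.2) * (u' (0, e.2))⁻¹) - 1) * (scalarPart (linkQ L u v v' g e) - 1)) -
        2 * (vecPart (u (0, e.2) * (u' (0, e.2))⁻¹) ⬝ᵥ (vecPart (linkQ L u v v' g e) -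
          fun c => -(v' e c) + -(vecPart (g e.1) c) + v e c + ((adRot (u (0, e.2))) *ᵥ vecPart (g (e.1.shift e.2))) c)) -
        2 * (vecPart (u (0, e.2) * (u' (0, e.2))⁻¹) ⬝ᵥ ((adRot (u (0, e.2))) *ᵥ vecPart (g (e.1.shift e.2)) - vecPart (g e.1))) -
        2 * (vecPart (u (0, e.2) * (u' (0, e.2))⁻¹) ⬝ᵥ v e) + 2 * (vecPart (u (0, e.2) * (u' (0, e.2))⁻¹) ⬝ᵥ v' e) := fun e => by
    rw [hdec e]; ring
  have h1 : ∑ e : Edge 3 L, vecPart (u (0, e.2) * (u' (0, e.2))⁻¹) ⬝ᵥ v e = 0 :=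
    sum_dotProduct_balanced_eq_zero (fun k => vecPart (u (0, k) * (u' (0, k))⁻¹)) hv.1
  have h2 : ∑ e : Edge 3 L, vecPart (u (0, e.2) * (u' (0, e.2))⁻¹) ⬝ᵥ v' e = 0 :=
    sum_dotProduct_balanced_eq_zero (fun k => vecPart (u (0, k) * (u' (0, k))⁻¹)) hv'.1
  have h3 : ∑ e : Edge 3 L, vecPart (u (0, e.2) * (u' (0, e.2))⁻¹) ⬝ᵥ ((adRot (u (0, e.2))) *ᵥ vecPart (g (e.1.shift e.2)) - vecPart (g e.1)) =
      ∑ k : Fin 3, vecPart (u (0, k) * (u' (0, k))⁻¹) ⬝ᵥ ((adRot (u (0, k))) *ᵥ (∑ x : Site 3 L, vecPart (g x)) - ∑ x : Site 3 L, vecPart (g x)) :=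
    sum_dotProduct_adRot_shift_sub_eq (fun k => vecPart (u (0, k) * (u' (0, k))⁻¹)) u (fun x => vecPart (g x))
  rw [Finset.sum_congr rfl fun e _ => hsplit e]
  simp only [Finset.sum_add_distrib, Finset.sum_sub_distrib, ← Finset.mul_sum]
  rw [h1, h2, h3, mul_zero, sub_zero, add_zero]
  -- per-term bounds
  have bA : ∀ e : Edge 3 L, |(scalarPart (u (0, e.2) * (u' (0, e.2))⁻¹) - 1) * (scalarPart (linkQ L u v v' g e) - 1)| ≤ 3 * α ^ 2 * (93 * t ^ 2) := fun e => by
    rw [abs_mul, abs_sub_comm, abs_of_nonneg (by linarith [(abs_le.mp (abs_scalarPart_le (u (0, e.2) * (u' (0, e.2))⁻¹))).2]), abs_sub_comm,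
      abs_of_nonneg (by linarith [(abs_le.mp (abs_scalarPart_le (linkQ L u v v' g e))).2])]
    exact mul_le_mul (one_sub_scalarPart_le_three_sq (hw0 e.2) (ha e.2)) (near e).2.2 (by linarith [(abs_le.mp (abs_scalarPart_le (linkQ L u v v' g e))).2])
      (by positivity)
  have bR : ∀ e : Edge 3 L, |vecPart (u (0, e.2) * (u' (0, e.2))⁻¹) ⬝ᵥ (vecPart (linkQ L u v v' g e) -
      fun c => -(v' e c) + -(vecPart (g e.1) c) + v e c + ((adRot (u (0, e.2))) *ᵥ vecPart (g (e.1.shift e.2))) c)| ≤ 3 * (α * (32 * t ^ 2)) := fun e => by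
    refine (abs_dotProduct_le_three _ _).trans (mul_le_mul_of_nonneg_left (mul_le_mul ?_ ?_ (norm_nonneg _) hα0) (by norm_num))
    · exact (pi_norm_le_iff_of_nonneg hα0).mpr fun c => by rw [Real.norm_eq_abs]; exact ha e.2 c
    · exact (pi_norm_le_iff_of_nonneg (by positivity)).mpr fun c => by rw [Real.norm_eq_abs, Pi.sub_apply]; exact (near e).1 c
  have bK : ∀ k : Fin 3, |vecPart (u (0, k) * (u' (0, k))⁻¹) ⬝ᵥ ((adRot (u (0, k))) *ᵥ (∑ x : Site 3 L, vecPart (g x)) - ∑ x : Site 3 L, vecPart (g x))| ≤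
      3 * (α * (12 * τu * Γ)) := fun k => by
    refine (abs_dotProduct_le_three _ _).trans (mul_le_mul_of_nonneg_left (mul_le_mul ?_ ?_ (norm_nonneg _) hα0) (by norm_num))
    · exact (pi_norm_le_iff_of_nonneg hα0).mpr fun c => by rw [Real.norm_eq_abs]; exact ha k c
    · refine (norm_adRot_mulVec_sub_self_le _ _).trans ?_
      exact mul_le_mul (mul_le_mul_of_nonneg_left (hu k) (by norm_num)) hΓ (norm_nonneg _) (by positivity)
  have sA : |∑ e : Edge 3 L, (scalarPart (u (0, e.2) * (u' (0, e.2))⁻¹) - 1) * (scalarPart (linkQ L u v v' g e) - 1)| ≤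
      (Fintype.card (Edge 3 L) : ℝ) * (3 * α ^ 2 * (93 * t ^ 2)) := by
    refine (Finset.abs_sum_le_sum_abs _ _).trans ?_
    refine (Finset.sum_le_sum fun e _ => bA e).trans ?_
    rw [Finset.sum_const, Finset.card_univ, nsmul_eq_mul]
  have sR : |∑ e : Edge 3 L, vecPart (u (0, e.2) * (u' (0, e.2))⁻¹) ⬝ᵥ (vecPart (linkQ L u v v' g e) -
      fun c => -(v' e c) + -(vecPart (g e.1) c) + v e c + ((adRot (u (0, e.2))) *ᵥ vecPart (g (e.1.shift e.2))) c)| ≤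
      (Fintype.card (Edge 3 L) : ℝ) * (3 * (α * (32 * t ^ 2))) := by
    refine (Finset.abs_sum_le_sum_abs _ _).trans ?_
    refine (Finset.sum_le_sum fun e _ => bR e).trans ?_
    rw [Finset.sum_const, Finset.card_univ, nsmul_eq_mul]
  have sK : |∑ k : Fin 3, vecPart (u (0, k) * (u' (0, k))⁻¹) ⬝ᵥ ((adRot (u (0, k))) *ᵥ (∑ x : Site 3 L, vecPart (g x)) - ∑ x : Site 3 L, vecPart (g x))| ≤
      3 * (3 * (α * (12 * τu * Γ))) := by
    refine (Finset.abs_sum_le_sum_abs _ _).trans ?_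
    refine (Finset.sum_le_sum fun k _ => bK k).trans ?_
    rw [Finset.sum_const, Finset.card_univ, Fintype.card_fin, nsmul_eq_mul, Nat.cast_ofNat]
  have hcard0 : (0 : ℝ) ≤ Fintype.card (Edge 3 L) := Nat.cast_nonneg _
  rw [abs_le]
  constructor
  · have e1 := (abs_le.mp sA).1; have e2 := (abs_le.mp sR).2; have e3 := (abs_le.mp sK).2
    nlinarith [e1, e2, e3]
  · have e1 := (abs_le.mp sA).2; have e2 := (abs_le.mp sR).1; have e3 := (abs_le.mp sK).1
    nlinarith [e1, e2, e3]

/-! ## §5 ★★ The magnetic bound -/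

/-- ★★ **The off-diagonal magnetic term**: `|(S(oT u' v') − L³S₁u') − (S(oT u v') − L³S₁u)| ≤ 100σN‖v̂'‖² + 2E(t,σ) + 10080·α·N‖v̂'‖²`. [cite: Luscher1983, §3] -/
theorem abs_offMagnetic_le (u u' : GaugeConfig 3 1 SU2) {v' : Edge 3 L → Fin 3 → ℝ} (hv' : v' ∈ capBalancedSet L) {t σ α : ℝ} (ht : t ≤ 1 / 30) (hσ : σ < 2)
    (hS : (L : ℝ) ^ 3 * wilsonAction su2Rep u ≤ σ) (hS' : (L : ℝ) ^ 3 * wilsonAction su2Rep u' ≤ σ) (hv't : ∀ (e : Edge 3 L) (c : Fin 3), |v' e c| ≤ t)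
    (hα1 : α ≤ 1) (ha : ∀ k c, |vecPart (u (0, k) * (u' (0, k))⁻¹) c| ≤ α) :
    |(wilsonAction su2Rep (orthoTube L u' v') - (L : ℝ) ^ 3 * wilsonAction su2Rep u') - (wilsonAction su2Rep (orthoTube L u v') - (L : ℝ) ^ 3 * wilsonAction su2Rep u)| ≤
      100 * σ * (Fintype.card (Plaquette 3 L × Fin 3) : ℝ) * ‖linkEmbed L v'‖ ^ 2 + 2 * stepActionErr (L := L) t σ +
        10080 * α * (Fintype.card (Plaquette 3 L × Fin 3) : ℝ) * ‖linkEmbed L v'‖ ^ 2 := by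
  have hα0 : 0 ≤ α := (abs_nonneg _).trans (ha 0 0)
  have hσ0 : 0 ≤ σ := le_trans (mul_nonneg (by positivity) (wilsonAction_su2_nonneg u)) hS
  have hN0 : (0 : ℝ) ≤ Fintype.card (Plaquette 3 L × Fin 3) := Nat.cast_nonneg _
  have hsN : Real.sqrt (Fintype.card (Plaquette 3 L × Fin 3) : ℝ) * Real.sqrt (Fintype.card (Plaquette 3 L × Fin 3) : ℝ) = Fintype.card (Plaquette 3 L × Fin 3) :=
    Real.mul_self_sqrt hN0
  have h1 := abs_wilsonAction_orthoTube_sub_le u' hv' ht hσ hS' hv't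
  have h2 := abs_wilsonAction_orthoTube_sub_le u hv' ht hσ hS hv't
  have hD := norm_covCurl_le_op (constLift L u) (linkEmbed L v')
  have hD' := norm_covCurl_le_op (constLift L u') (linkEmbed L v')
  -- the constant step from `u` to `u'`
  have hstep : constLift L (fun e => u' e * (u e)⁻¹) * constLift L u = constLift L u' := by
    rw [← constLift_mul]; congr 1; funext e; simp only [Pi.mul_apply, inv_mul_cancel_right]
  have hwv : ∀ (e : Edge 3 L) (c : Fin 3), |vecPart (constLift L (fun e => u' e * (u e)⁻¹) e) c| ≤ α := fun e c => by
    rw [constLift_apply]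
    rw [show u' (0, e.2) * (u (0, e.2))⁻¹ = (u (0, e.2) * (u' (0, e.2))⁻¹)⁻¹ by rw [mul_inv_rev, inv_inv], vecPart_inv, Pi.neg_apply, abs_neg]
    exact ha e.2 c
  have hL := norm_covCurl_step_sub_le (constLift L u) hα1 hwv (linkEmbed L v')
  rw [hstep] at hL
  have hsq : |‖covCurl (constLift L u') (linkEmbed L v')‖ ^ 2 - ‖covCurl (constLift L u) (linkEmbed L v')‖ ^ 2| ≤
      10080 * α * (Fintype.card (Plaquette 3 L × Fin 3) : ℝ) * ‖linkEmbed L v'‖ ^ 2 := by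
    have e1 : ‖covCurl (constLift L u') (linkEmbed L v')‖ ^ 2 - ‖covCurl (constLift L u) (linkEmbed L v')‖ ^ 2 =
        (‖covCurl (constLift L u') (linkEmbed L v')‖ - ‖covCurl (constLift L u) (linkEmbed L v')‖) *
          (‖covCurl (constLift L u') (linkEmbed L v')‖ + ‖covCurl (constLift L u) (linkEmbed L v')‖) := by ring
    have e2 := (abs_norm_sub_norm_le (covCurl (constLift L u') (linkEmbed L v')) (covCurl (constLift L u) (linkEmbed L v'))).trans hL
    rw [e1, abs_mul, abs_of_nonneg (by positivity : (0 : ℝ) ≤ ‖covCurl (constLift L u') (linkEmbed L v')‖ + ‖covCurl (constLift L u) (linkEmbed L v')‖)]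
    refine (mul_le_mul e2 (add_le_add hD' hD) (by positivity) (by positivity)).trans ?_
    have e3 : 504 * α * Real.sqrt (Fintype.card (Plaquette 3 L × Fin 3) : ℝ) * ‖linkEmbed L v'‖ *
        (10 * Real.sqrt (Fintype.card (Plaquette 3 L × Fin 3) : ℝ) * ‖linkEmbed L v'‖ + 10 * Real.sqrt (Fintype.card (Plaquette 3 L × Fin 3) : ℝ) * ‖linkEmbed L v'‖) =
        10080 * α * (Real.sqrt (Fintype.card (Plaquette 3 L × Fin 3) : ℝ) * Real.sqrt (Fintype.card (Plaquette 3 L × Fin 3) : ℝ)) * ‖linkEmbed L v'‖ ^ 2 := by ring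
    rw [e3, hsN]
  have hD2 : ‖covCurl (constLift L u) (linkEmbed L v')‖ ^ 2 ≤ 100 * (Fintype.card (Plaquette 3 L × Fin 3) : ℝ) * ‖linkEmbed L v'‖ ^ 2 := by
    have h := pow_le_pow_left₀ (norm_nonneg _) hD 2
    have e : (10 * Real.sqrt (Fintype.card (Plaquette 3 L × Fin 3) : ℝ) * ‖linkEmbed L v'‖) ^ 2 =
        100 * (Real.sqrt (Fintype.card (Plaquette 3 L × Fin 3) : ℝ) * Real.sqrt (Fintype.card (Plaquette 3 L × Fin 3) : ℝ)) * ‖linkEmbed L v'‖ ^ 2 := by ring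
    rw [e, hsN] at h; exact h
  have hD'2 : ‖covCurl (constLift L u') (linkEmbed L v')‖ ^ 2 ≤ 100 * (Fintype.card (Plaquette 3 L × Fin 3) : ℝ) * ‖linkEmbed L v'‖ ^ 2 := by
    have h := pow_le_pow_left₀ (norm_nonneg _) hD' 2
    have e : (10 * Real.sqrt (Fintype.card (Plaquette 3 L × Fin 3) : ℝ) * ‖linkEmbed L v'‖) ^ 2 =
        100 * (Real.sqrt (Fintype.card (Plaquette 3 L × Fin 3) : ℝ) * Real.sqrt (Fintype.card (Plaquette 3 L × Fin 3) : ℝ)) * ‖linkEmbed L v'‖ ^ 2 := by ring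
    rw [e, hsN] at h; exact h
  have hA := abs_le.mp h1
  have hB := abs_le.mp h2
  have hC := abs_le.mp hsq
  have hσD : σ / 2 * ‖covCurl (constLift L u) (linkEmbed L v')‖ ^ 2 ≤ σ / 2 * (100 * (Fintype.card (Plaquette 3 L × Fin 3) : ℝ) * ‖linkEmbed L v'‖ ^ 2) :=
    mul_le_mul_of_nonneg_left hD2 (by linarith)
  have hσD' : σ / 2 * ‖covCurl (constLift L u') (linkEmbed L v')‖ ^ 2 ≤ σ / 2 * (100 * (Fintype.card (Plaquette 3 L × Fin 3) : ℝ) * ‖linkEmbed L v'‖ ^ 2) :=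
    mul_le_mul_of_nonneg_left hD'2 (by linarith)
  rw [abs_le]
  constructor <;> linarith

/-! ## §6 ★★★ The pointwise bound on `offX` -/

/-- ★★★ **POINTWISE BOUND ON THE OFF-DIAGONAL EXPONENT** on the core. [cite: Luscher1983, §3] -/
theorem abs_offX_le {β : ℝ} (hβ : 0 ≤ β) (u u' : GaugeConfig 3 1 SU2) {v v' : Edge 3 L → Fin 3 → ℝ} (hv : v ∈ capBalancedSet L) (hv' : v' ∈ capBalancedSet L)
    {t σ α τu Γ : ℝ} (ht : t ≤ 1 / 30) (hσ : σ < 2) (hS : (L : ℝ) ^ 3 * wilsonAction su2Rep u ≤ σ) (hS' : (L : ℝ) ^ 3 * wilsonAction su2Rep u' ≤ σ)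
    (hvt : ∀ (e : Edge 3 L) (c : Fin 3), |v e c| ≤ t) (hv't : ∀ (e : Edge 3 L) (c : Fin 3), |v' e c| ≤ t) {g : Site 3 L → SU2}
    (hg0 : ∀ x, 0 ≤ scalarPart (g x)) (hgt : ∀ x, ∑ c, vecPart (g x) c ^ 2 ≤ t ^ 2) (hΓ : ‖∑ x, vecPart (g x)‖ ≤ Γ) (hα1 : α ≤ 1)
    (ha : ∀ k c, |vecPart (u (0, k) * (u' (0, k))⁻¹) c| ≤ α) (hw0 : ∀ k, 0 ≤ scalarPart (u (0, k) * (u' (0, k))⁻¹)) (hu : ∀ k, ‖vecPart (u (0, k))‖ ≤ τu) :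
    |offX L β u u' v v' g| ≤
      β * ((Fintype.card (Edge 3 L) : ℝ) * (558 * α ^ 2 * t ^ 2 + 192 * α * t ^ 2) + 216 * α * τu * Γ) +
        β / 2 * (100 * σ * (Fintype.card (Plaquette 3 L × Fin 3) : ℝ) * ‖linkEmbed L v'‖ ^ 2 + 2 * stepActionErr (L := L) t σ +
          10080 * α * (Fintype.card (Plaquette 3 L × Fin 3) : ℝ) * ‖linkEmbed L v'‖ ^ 2) := by
  have hK := abs_offKinetic_le u u' hv hv' (by linarith) hvt hv't hg0 hgt hΓ ha hw0 hu
  have hM := abs_offMagnetic_le u u' hv' ht hσ hS hS' hv't hα1 ha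
  have e : offX L β u u' v v' g =
      β * ∑ e : Edge 3 L, 2 * ((scalarPart (u (0, e.2) * (u' (0, e.2))⁻¹) - 1) * (scalarPart (linkQ L u v v' g e) - 1) -
          vecPart (u (0, e.2) * (u' (0, e.2))⁻¹) ⬝ᵥ vecPart (linkQ L u v v' g e)) -
        β / 2 * ((wilsonAction su2Rep (orthoTube L u' v') - (L : ℝ) ^ 3 * wilsonAction su2Rep u') - (wilsonAction su2Rep (orthoTube L u v') - (L : ℝ) ^ 3 * wilsonAction su2Rep u)) := by
    unfold offX; rw [offKinetic_eq]
  rw [e]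
  refine (abs_sub _ _).trans ?_
  rw [abs_mul, abs_mul, abs_of_nonneg hβ, abs_of_nonneg (by linarith : (0 : ℝ) ≤ β / 2)]
  exact add_le_add (mul_le_mul_of_nonneg_left hK hβ) (mul_le_mul_of_nonneg_left hM (by linarith))

end Summit.QuantumFields.YangMills.Theorems.FemtoTransferGap.TwoLattice.ConstTube

end
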